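import Summits.QuantumFields.BalabanUV.T4Continuum.Support.NE7FluxGradientFromTension
import Summits.QuantumFields.BalabanUV.T4Continuum.Support.AveragingDeficitDualResidual

/-!
# NE7TensionPairing — STEP (E2)-0 OF THE ENERGY ROAD: THE FIRST VARIATION OF THE PERIODIC WILSON ACTION IS THE TENSION PAIRING
# `d/ds|₀ A(U e^{sψ}) = Σ_x Σ_ν hsR (Ad_{U(x,ν)} ψ(x,ν)) ((δ_U F)_ν(x)) + O(a²·‖ψ‖_{ℓ¹})` — so at a configuration that is critical along `ψ`
# the tension is `a²`-orthogonal to `ψ`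

Cell `pub-balaban`, rung (B)+1 sub-cell t4, lineage `b2b-balaban-t4-ne7-p1`, generation 62 (CRUX PROVER NE7 #1, ruling e34b3e0c (2)); hunt (h7)
«ENERGY ROAD» (`t4/b2b-balaban-t4-ne7-p1-g61/HUNT-H7-ENERGY-ROAD.md`), step (E2) «first-order condition at an interior constrained minimiser:
`⟨δ_U F, ψ⟩ = 0` up to the `a`-small weights for every `ψ` tangent to `{avgIter_k = V}`».  THIS file is its configuration-level half, the
bridge between a CRITICALITY statement `HasDerivAt (s ↦ fineAction (vary U ψ s) (plaqsOf (periodBox P))) 0 0` (the shape the tree's Lagrange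
argument produces: `NE3FineCriticalGeneral.hasDerivAt_fineAction_vary_of_isMinOn` for ONE averaging step) and the TENSION
`T_ν(x) = Σ_μ ∇_μ^† B_{μν}(x)` of the flux form that step (E1) consumes (`NE7FluxGradientFromTension.gradFluxSq_le_tension`):

* §1 `hsR_eq_neg_nReTr_mul` (`hsR X Y = −Re tr(XY)∕n` for skew `X`); **`weight_pairing`**: per plaquette,
  `|−Re tr((d_Uψ)(p)·U(∂p))∕n − hsR ((d_Uψ)(p)) (F(p))| ≤ 4a²·‖(d_Uψ)(p)‖` (`AveragingDeficitNearIdentity.abs_nReTr_mul_sub_mul_mlog_le`: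
  `Re tr` of a skew matrix vanishes and `U(∂p) − 1 − F = O(F²)`);
* §2 **`curl_pairing`**: `hsR ((d_Uψ)(x;μ<ν)) (B_{μν}) = hsR (covFd_{μν} − covFd_{νμ}) (B_{μν}) + hsR (curlRem) (B_{μν})`, the last `≤ 4a²·(‖ψ(x+e_ν,μ)‖ + ‖ψ(x,ν)‖)`
  (NE3-R2's `curlAt_eq_covFd_sub_add`, `norm_curlRem_le`, and `‖B‖ ≤ 2a`);
* §3 **`sum_antisym_pairing_eq_tension_pairing`**: over one period, `Σ_x Σ_π hsR (covFd_{π₁π₂} − covFd_{π₂π₁}) (B_{π₁π₂}) = Σ_x Σ_ν hsR (frame U ψ x ν) (T_ν(x))`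
  (plane∕pair bookkeeping, `cD_frame`, the periodic covariant summation by parts `sum_hsR_cD`, `hsR_sum_right`);
* §4 **`firstVariation_sub_tension_pairing_le`**: for `P ≥ 1`, unitary `P`-periodic `U` in `SmallField U a` (`0 ≤ a ≤ 1∕4`), a skew `P`-periodic `ψ`,
  the flux form `B`, and ANY derivative `D` of `s ↦ fineAction (vary U ψ s) (plaqsOf (periodBox P))` at `0`:
  `|D − Σ_x Σ_ν hsR (frame U ψ x ν) (T_ν(x))| ≤ 12·#Plane(d)·a²·dirL1 ψ (periodBox P)`; and **`tension_pairing_le_of_critical`**: if `U` is critical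
  along `ψ` (`D = 0`) then `|Σ_x Σ_ν hsR (frame U ψ x ν) (T_ν(x))| ≤ 12·#Plane(d)·a²·dirL1 ψ (periodBox P)`.
With `a = ε(L^k)^{−2}` the right side is `O(ε²η⁴)·‖ψ‖_{ℓ¹}`: the tension of a critical configuration is invisible to first order along tangent
directions — the input of step (E3) (size of the multiplier ∕ `QQ^*` for the linearised `k`-fold average), which with (E1) would give (H∃)ᵀ hence
(H∃)ᴱ (`NE7EtaBackgroundTensionClass.hminE_of_tension`); (E3), the `k`-fold criticality itself and the interiority (8) are NOT proved here.
HONEST FRAMING (page 1): FIXED FINITE torus, rung (B)+1; [folklore] lattice gauge calculus at ONE configuration (context only: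
[Balaban1985Variational] (5) p.278 the Wilson weight, (26)–(27) p.281 the first variation); NE7, NE3 NOT PRINTED in
[Balaban1984PropagatorsI]–[Balaban1989LargeFieldII] and NOT PROVED; continuum YM on T⁴ ⇐ BetaPertH ∧ nine spine estimates (0/9 proved);
BetaPertH ⇐ (D1) ∧ (D4) ∧ CAP+tail; G-an2-4 gates asym, D1 and NE2/3/4; NOT infinite volume, NOT mass gap, NOT Clay.  0 def, 0 sorry.
-/

set_option autoImplicit false

open scoped BigOperators Matrix Matrix.Norms.L2Operator Topology
open NormedSpace Finset

namespace Summit.QuantumFields.BalabanUV.T4Continuum.NE7TensionPairing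

open Literature.MathematicalPhysics.QuantumFieldTheory.Balaban1983to89
open B7Prop1Explicit B7Prop2Explicit MatrixLog UnitaryModel MatrixNorms
open T4AveragingDeficitWall hiding Site Plane Plaq Bond
open T4AveragingDeficitWallBoundary (periodBox sum_periodBox_shift IsPeriodicCfg)
open T4AveragingDeficitNonAbelian (Ad_mul Ad_sub)
open AveragingDeficitTransport (norm_Ad_of_unitary curl_mem_skewAdjoint nReTr_eq_zero_of_mem_skewAdjoint)
open AveragingDeficitNearIdentity (abs_nReTr_mul_sub_mul_mlog_le abs_nReTr_mul_le Ad_neg)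
open AveragingDeficitPeriodicCounting (IsPeriodicDir)
open AveragingDeficitCovGrad (covFd curlRem curlAt_eq_covFd_sub_add norm_curlRem_le)
open AveragingDeficitDualResidual (curlL1_le_periodic pair_le_sum)
open NE3HessShapes (plaqsOf sum_plaqsOf)
open NE3LatticeWeitzenbock (sum_sum_eq_two_mul_sum_plane)
open NE3CovariantCalculus
open NE3CovariantWeitzenbock (frame cD_frame frame_periodic norm_frame plaq_bound_of_smallField)
open NE7CovariantWeitzenbockTwoForm (hsR_neg_self)
open NE7FluxGradientFromTension (fluxForm_diag norm_fluxForm_le fluxForm_periodic)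

noncomputable section

variable {d : ℕ} {n : Type*} [Fintype n] [DecidableEq n]

/-! ## §1 The Wilson-weight derivative against the flux pairing, per plaquette -/

omit [DecidableEq n] in
/-- For skew `X`: `hsR X Y = −Re tr(X·Y)∕n`. [folklore] -/
theorem hsR_eq_neg_nReTr_mul {X : Matrix n n ℂ} (hX : X ∈ skewAdjoint (Matrix n n ℂ)) (Y : Matrix n n ℂ) :
    hsR X Y = -nReTr (X * Y) := by
  unfold hsR
  rw [skewAdjoint.mem_iff, Matrix.star_eq_conjTranspose] at hX
  rw [hX, neg_mul, ← nReTrL_apply, map_neg, nReTrL_apply]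

/-- **THE WILSON-WEIGHT DERIVATIVE IS THE FLUX PAIRING UP TO `4a²‖d_Uψ‖`**: for unitary `U` in `SmallField U a`, `a ≤ 1∕4`, skew `ψ` and a
plaquette `p`: `|−Re tr((d_Uψ)(p)·U(∂p))∕n − hsR ((d_Uψ)(p)) (F(p))| ≤ 4·a²·‖(d_Uψ)(p)‖`. [folklore] -/
theorem weight_pairing [Nonempty n] {U : Site d → Fin d → (Matrix n n ℂ)ˣ} (hU : IsUnitaryCfg U) {ψ : Site d → Fin d → Matrix n n ℂ}
    (hψ : IsSkewDir ψ) {a : ℝ} (ha : a ≤ 1 / 4) (hUa : SmallField U a) (p : T4AveragingDeficitWall.Plaq d) :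
    |-nReTr (curl U ψ p * ((fhol U p : (Matrix n n ℂ)ˣ) : Matrix n n ℂ)) - hsR (curl U ψ p) (flux U p)| ≤ 4 * a ^ 2 * ‖curl U ψ p‖ := by
  have hskew := curl_mem_skewAdjoint hU hψ p
  have hC : ‖((fhol U p : (Matrix n n ℂ)ˣ) : Matrix n n ℂ) - 1‖ ≤ a := hUa p.1 p.2.1.1 p.2.1.2 (ne_of_lt p.2.2)
  have ha0 : 0 ≤ a := (norm_nonneg _).trans hC
  have h := abs_nReTr_mul_sub_mul_mlog_le hskew (hC.trans ha)
  rw [hsR_eq_neg_nReTr_mul hskew]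
  unfold flux
  rw [show -nReTr (curl U ψ p * ((fhol U p : (Matrix n n ℂ)ˣ) : Matrix n n ℂ))
      - -nReTr (curl U ψ p * mlog ((fhol U p : (Matrix n n ℂ)ˣ) : Matrix n n ℂ))
      = -(nReTr (curl U ψ p * ((fhol U p : (Matrix n n ℂ)ˣ) : Matrix n n ℂ))
        - nReTr (curl U ψ p * mlog ((fhol U p : (Matrix n n ℂ)ˣ) : Matrix n n ℂ))) by ring, abs_neg]
  refine h.trans ?_
  have hc0 : 0 ≤ ‖curl U ψ p‖ := norm_nonneg _
  have hsq : ‖((fhol U p : (Matrix n n ℂ)ˣ) : Matrix n n ℂ) - 1‖ ^ 2 ≤ a ^ 2 := pow_le_pow_left₀ (norm_nonneg _) hC 2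
  nlinarith

/-! ## §2 The dressed curl against the flux form: the antisymmetrised covariant difference plus an `O(a²)` remainder -/

section FluxForm

variable {U : Site d → Fin d → (Matrix n n ℂ)ˣ} {B : Site d → Fin d → Fin d → Matrix n n ℂ} {ψ : Site d → Fin d → Matrix n n ℂ}

/-- **THE CURL PAIRING**: at the plaquette `(x; μ<ν)`, `hsR ((d_Uψ)(x;μ,ν)) (B_{μν}(x)) = hsR (covFd_{μν} − covFd_{νμ}) (B_{μν}(x)) + hsR (curlRem) (B_{μν}(x))`
(NE3-R2's curl identity). [folklore] -/
theorem curl_pairing (x : Site d) (π : T4AveragingDeficitWall.Plane d) :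
    hsR (curl U ψ (x, π)) (B x π.1.1 π.1.2)
      = hsR (covFd U ψ x π.1.1 π.1.2 - covFd U ψ x π.1.2 π.1.1) (B x π.1.1 π.1.2) + hsR (curlRem U ψ x π.1.1 π.1.2) (B x π.1.1 π.1.2) := by
  rw [show curl U ψ (x, π) = curlAt U ψ x π.1.1 π.1.2 from rfl, curlAt_eq_covFd_sub_add, hsR_add_left]

/-- The remainder of the curl pairing is `O(a²)`: `|hsR (curlRem) (B_{μν}(x))| ≤ 4a²·(‖ψ(x+e_ν,μ)‖ + ‖ψ(x,ν)‖)` in `SmallField U a`, `0 ≤ a ≤ ½`.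
[folklore] -/
theorem abs_curlRem_pairing_le [Nonempty n] (hU : IsUnitaryCfg U) {a : ℝ} (ha0 : 0 ≤ a) (ha : a ≤ 1 / 2) (hUa : SmallField U a)
    (hBF : ∀ (x : Site d) (μ ν : Fin d) (h : μ < ν), B x μ ν = flux U (x, ⟨(μ, ν), h⟩))
    (hanti : ∀ (x : Site d) (μ ν : Fin d), B x ν μ = -B x μ ν) (x : Site d) (π : T4AveragingDeficitWall.Plane d) :
    |hsR (curlRem U ψ x π.1.1 π.1.2) (B x π.1.1 π.1.2)| ≤ 4 * a ^ 2 * (‖ψ (x + e π.1.2) π.1.1‖ + ‖ψ x π.1.2‖) := by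
  refine (abs_hsR_le _ _).trans ?_
  have hR := norm_curlRem_le hU ψ x (μ := π.1.1) (ν := π.1.2) (plaq_bound_of_smallField ha0 hUa x π.1.1 π.1.2)
  have hB := norm_fluxForm_le ha0 ha hUa hBF hanti x π.1.1 π.1.2
  have h0 : 0 ≤ ‖ψ (x + e π.1.2) π.1.1‖ + ‖ψ x π.1.2‖ := by positivity
  calc ‖curlRem U ψ x π.1.1 π.1.2‖ * ‖B x π.1.1 π.1.2‖
      ≤ (2 * a * (‖ψ (x + e π.1.2) π.1.1‖ + ‖ψ x π.1.2‖)) * (2 * a) :=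
        mul_le_mul hR hB (norm_nonneg _) (by positivity)
    _ = 4 * a ^ 2 * (‖ψ (x + e π.1.2) π.1.1‖ + ‖ψ x π.1.2‖) := by ring

/-! ## §3 The antisymmetrised pairing summed over a period is the tension pairing -/

/-- Pointwise plane∕pair bookkeeping: `Σ_π hsR (covFd_{π₁π₂} − covFd_{π₂π₁}) (B_{π₁π₂}) = Σ_μ Σ_ν hsR (covFd_{μν}) (B_{μν})` for antisymmetric `B`.
[folklore] -/
theorem sum_plane_antisym_pairing (hanti : ∀ (x : Site d) (μ ν : Fin d), B x ν μ = -B x μ ν) (x : Site d) :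
    ∑ π : T4AveragingDeficitWall.Plane d, hsR (covFd U ψ x π.1.1 π.1.2 - covFd U ψ x π.1.2 π.1.1) (B x π.1.1 π.1.2)
      = ∑ μ : Fin d, ∑ ν : Fin d, hsR (covFd U ψ x μ ν) (B x μ ν) := by
  have h0R : ∀ X : Matrix n n ℂ, hsR X 0 = 0 := fun X => by unfold hsR; simp [nReTr]
  have hnegR : ∀ X Y : Matrix n n ℂ, hsR X (-Y) = -hsR X Y := fun X Y => by
    have h := hsR_sub_right X 0 Y; rw [zero_sub, h0R] at h; linarith
  have hnegL : ∀ X Y : Matrix n n ℂ, hsR (-X) Y = -hsR X Y := fun X Y => by rw [hsR_comm, hnegR, hsR_comm]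
  set g : Fin d → Fin d → ℝ := fun μ ν => hsR (covFd U ψ x μ ν - covFd U ψ x ν μ) (B x μ ν) with hg
  have hdiag : ∀ μ, g μ μ = 0 := fun μ => by
    simp only [hg, sub_self]
    rw [hsR_comm]; exact h0R _
  have hsymm : ∀ μ ν, g μ ν = g ν μ := fun μ ν => by
    simp only [hg]
    rw [hanti x μ ν, ← neg_sub (covFd U ψ x μ ν) (covFd U ψ x ν μ), hnegL, hnegR, neg_neg]
  have h2 := sum_sum_eq_two_mul_sum_plane g hdiag hsymm
  -- `Σ_μ Σ_ν g μ ν = 2·Σ_μ Σ_ν hsR (covFd μν) (B μν)`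
  have hpair : ∑ μ : Fin d, ∑ ν : Fin d, g μ ν = 2 * ∑ μ : Fin d, ∑ ν : Fin d, hsR (covFd U ψ x μ ν) (B x μ ν) := by
    have e1 : ∀ μ ν, g μ ν = hsR (covFd U ψ x μ ν) (B x μ ν) + hsR (covFd U ψ x ν μ) (B x ν μ) := fun μ ν => by
      simp only [hg]
      rw [hsR_sub_left, hanti x μ ν, hnegR]
      ring
    simp only [e1, Finset.sum_add_distrib]
    rw [Finset.sum_comm (f := fun μ ν => hsR (covFd U ψ x ν μ) (B x ν μ))]
    ring
  have hplane : ∑ π : T4AveragingDeficitWall.Plane d, hsR (covFd U ψ x π.1.1 π.1.2 - covFd U ψ x π.1.2 π.1.1) (B x π.1.1 π.1.2)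
      = ∑ π : T4AveragingDeficitWall.Plane d, g π.1.1 π.1.2 := rfl
  rw [hplane]
  linarith

/-- **THE ANTISYMMETRISED COVARIANT-DIFFERENCE PAIRING OVER ONE PERIOD IS THE TENSION PAIRING**: for `P ≥ 1`, unitary `P`-periodic `U`,
`P`-periodic `ψ` and a `P`-periodic antisymmetric `B`,
`Σ_{x ∈ periodBox P} Σ_π hsR (covFd_{π₁π₂} − covFd_{π₂π₁}) (B_{π₁π₂}(x)) = Σ_{x ∈ periodBox P} Σ_ν hsR (frame U ψ x ν) (Σ_μ ∇_μ^† B_{μν}(x))`. [folklore] -/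
theorem sum_antisym_pairing_eq_tension_pairing {P : ℕ} (hP : 1 ≤ P) (hU : IsUnitaryCfg U) (hUP : IsPeriodicCfg U (P : ℤ))
    (hψ : IsPeriodicDir ψ (P : ℤ)) (hBP : ∀ (x : Site d) (κ μ ν : Fin d), B (x + (P : ℤ) • e κ) μ ν = B x μ ν)
    (hanti : ∀ (x : Site d) (μ ν : Fin d), B x ν μ = -B x μ ν) :
    ∑ x ∈ periodBox (d := d) P, ∑ π : T4AveragingDeficitWall.Plane d,
        hsR (covFd U ψ x π.1.1 π.1.2 - covFd U ψ x π.1.2 π.1.1) (B x π.1.1 π.1.2)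
      = ∑ x ∈ periodBox (d := d) P, ∑ ν : Fin d, hsR (frame U ψ x ν) (∑ μ : Fin d, cDstar U μ (fun y => B y μ ν) x) := by
  -- pointwise: planes → ordered pairs, `covFd = cD ∘ frame`
  have hpt : ∀ x : Site d, ∑ π : T4AveragingDeficitWall.Plane d,
        hsR (covFd U ψ x π.1.1 π.1.2 - covFd U ψ x π.1.2 π.1.1) (B x π.1.1 π.1.2)
      = ∑ μ : Fin d, ∑ ν : Fin d, hsR (cD U μ (fun y => frame U ψ y ν) x) (B x μ ν) := by
    intro x
    rw [sum_plane_antisym_pairing hanti x]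
    simp only [cD_frame]
  rw [Finset.sum_congr rfl fun x _ => hpt x]
  -- summation by parts in each `(μ, ν)`
  have hparts : ∀ μ ν : Fin d, ∑ x ∈ periodBox (d := d) P, hsR (cD U μ (fun y => frame U ψ y ν) x) (B x μ ν)
      = ∑ x ∈ periodBox (d := d) P, hsR (frame U ψ x ν) (cDstar U μ (fun y => B y μ ν) x) :=
    fun μ ν => sum_hsR_cD hP hU hUP μ (f := fun y => frame U ψ y ν) (g := fun y => B y μ ν)
      (fun x κ => frame_periodic hUP hψ x κ ν) (fun x κ => hBP x κ μ ν)
  calc ∑ x ∈ periodBox (d := d) P, ∑ μ : Fin d, ∑ ν : Fin d, hsR (cD U μ (fun y => frame U ψ y ν) x) (B x μ ν)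
      = ∑ μ : Fin d, ∑ ν : Fin d, ∑ x ∈ periodBox (d := d) P, hsR (cD U μ (fun y => frame U ψ y ν) x) (B x μ ν) := by
        rw [Finset.sum_comm]; exact Finset.sum_congr rfl fun μ _ => Finset.sum_comm
    _ = ∑ μ : Fin d, ∑ ν : Fin d, ∑ x ∈ periodBox (d := d) P, hsR (frame U ψ x ν) (cDstar U μ (fun y => B y μ ν) x) :=
        Finset.sum_congr rfl fun μ _ => Finset.sum_congr rfl fun ν _ => hparts μ ν
    _ = ∑ ν : Fin d, ∑ x ∈ periodBox (d := d) P, ∑ μ : Fin d, hsR (frame U ψ x ν) (cDstar U μ (fun y => B y μ ν) x) := by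
        rw [Finset.sum_comm]; exact Finset.sum_congr rfl fun ν _ => Finset.sum_comm
    _ = ∑ x ∈ periodBox (d := d) P, ∑ ν : Fin d, ∑ μ : Fin d, hsR (frame U ψ x ν) (cDstar U μ (fun y => B y μ ν) x) :=
        Finset.sum_comm
    _ = ∑ x ∈ periodBox (d := d) P, ∑ ν : Fin d, hsR (frame U ψ x ν) (∑ μ : Fin d, cDstar U μ (fun y => B y μ ν) x) :=
        Finset.sum_congr rfl fun x _ => Finset.sum_congr rfl fun ν _ => (hsR_sum_right _ _ _).symm

/-! ## §4 The first variation of the periodic Wilson action against the tension pairing -/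

/-- **STEP (E2)-0 — THE FIRST VARIATION IS THE TENSION PAIRING UP TO `O(a²)·‖ψ‖_{ℓ¹}`.**  For `P ≥ 1`, a unitary `P`-periodic `U` in
`SmallField U a` (`0 ≤ a ≤ 1∕4`), a skew `P`-periodic direction field `ψ`, the flux form `B` of `U`, and ANY derivative `D` at `s = 0` of the
periodic Wilson action `s ↦ fineAction (vary U ψ s) (plaqsOf (periodBox P))` along `U e^{sψ}`:

  `|D − Σ_{x ∈ periodBox P} Σ_ν hsR (frame U ψ x ν) (Σ_μ ∇_μ^† B_{μν}(x))| ≤ 12·#Plane(d)·a²·dirL1 ψ (periodBox P)`.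

(`frame U ψ x ν = Ad_{U(x,ν)} ψ(x,ν)`; `Σ_μ ∇_μ^† B_{μν}` = the lattice Yang–Mills tension.)  Proof: `D = −Σ_p Re tr((d_Uψ)(p) U(∂p))∕n`
(`hasDerivAt_fineAction_vary`, uniqueness of derivatives), §1 per plaquette, §2 per plaquette, §3 for the main term, and the period sums
`curlL1 ≤ 2·#Plane·dirL1` (`AveragingDeficitDualResidual.curlL1_le_periodic`), `Σ_π (S_{π₁} + S_{π₂}) ≤ #Plane·dirL1`. [folklore] -/
theorem firstVariation_sub_tension_pairing_le [Nonempty n] {P : ℕ} (hP : 1 ≤ P) (hU : IsUnitaryCfg U) (hUP : IsPeriodicCfg U (P : ℤ))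
    {a : ℝ} (ha0 : 0 ≤ a) (ha : a ≤ 1 / 4) (hUa : SmallField U a) (hψs : IsSkewDir ψ) (hψP : IsPeriodicDir ψ (P : ℤ))
    (hBF : ∀ (x : Site d) (μ ν : Fin d) (h : μ < ν), B x μ ν = flux U (x, ⟨(μ, ν), h⟩))
    (hanti : ∀ (x : Site d) (μ ν : Fin d), B x ν μ = -B x μ ν) {D : ℝ}
    (hD : HasDerivAt (fun s : ℝ => fineAction (vary U ψ s) (plaqsOf (periodBox (d := d) P))) D 0) :
    |D - ∑ x ∈ periodBox (d := d) P, ∑ ν : Fin d, hsR (frame U ψ x ν) (∑ μ : Fin d, cDstar U μ (fun y => B y μ ν) x)|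
      ≤ 12 * (Fintype.card (T4AveragingDeficitWall.Plane d) : ℝ) * a ^ 2 * dirL1 ψ (periodBox (d := d) P) := by
  have ha2 : a ≤ 1 / 2 := ha.trans (by norm_num)
  -- the derivative is the tree's `−Σ_p Re tr((d_Uψ)(p)·U(∂p))∕n`
  have hDeq : D = -∑ p ∈ plaqsOf (periodBox (d := d) P), nReTr (curl U ψ p * ((fhol U p : (Matrix n n ℂ)ˣ) : Matrix n n ℂ)) :=
    hD.unique (hasDerivAt_fineAction_vary U ψ (plaqsOf (periodBox (d := d) P)))
  rw [hDeq, ← sum_antisym_pairing_eq_tension_pairing hP hU hUP hψP (fluxForm_periodic hUP hBF hanti) hanti,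
    ← Finset.sum_neg_distrib, sum_plaqsOf, ← Finset.sum_sub_distrib]
  simp_rw [← Finset.sum_sub_distrib]
  -- per plaquette: the two `O(a²)` errors
  have hpt : ∀ (x : Site d) (π : T4AveragingDeficitWall.Plane d),
      |-nReTr (curl U ψ (x, π) * ((fhol U (x, π) : (Matrix n n ℂ)ˣ) : Matrix n n ℂ))
          - hsR (covFd U ψ x π.1.1 π.1.2 - covFd U ψ x π.1.2 π.1.1) (B x π.1.1 π.1.2)|
        ≤ 4 * a ^ 2 * ‖curl U ψ (x, π)‖ + 4 * a ^ 2 * (‖ψ (x + e π.1.2) π.1.1‖ + ‖ψ x π.1.2‖) := by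
    intro x π
    have h1 := weight_pairing hU hψs ha hUa (x, π)
    have h2 := abs_curlRem_pairing_le (ψ := ψ) hU ha0 ha2 hUa hBF hanti x π
    have hF : flux U (x, π) = B x π.1.1 π.1.2 := (hBF x π.1.1 π.1.2 π.2).symm
    rw [hF, curl_pairing] at h1
    have e : -nReTr (curl U ψ (x, π) * ((fhol U (x, π) : (Matrix n n ℂ)ˣ) : Matrix n n ℂ))
          - hsR (covFd U ψ x π.1.1 π.1.2 - covFd U ψ x π.1.2 π.1.1) (B x π.1.1 π.1.2)
        = (-nReTr (curl U ψ (x, π) * ((fhol U (x, π) : (Matrix n n ℂ)ˣ) : Matrix n n ℂ))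
            - (hsR (covFd U ψ x π.1.1 π.1.2 - covFd U ψ x π.1.2 π.1.1) (B x π.1.1 π.1.2)
              + hsR (curlRem U ψ x π.1.1 π.1.2) (B x π.1.1 π.1.2)))
          + hsR (curlRem U ψ x π.1.1 π.1.2) (B x π.1.1 π.1.2) := by ring
    rw [e]
    exact (abs_add_le _ _).trans (add_le_add h1 h2)
  -- sum the per-plaquette bounds
  refine (Finset.abs_sum_le_sum_abs _ _).trans ?_
  refine (Finset.sum_le_sum fun x _ => (Finset.abs_sum_le_sum_abs _ _).trans (Finset.sum_le_sum fun π _ => hpt x π)).trans ?_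
  rw [Finset.sum_comm]
  simp only [Finset.sum_add_distrib, ← Finset.mul_sum]
  -- the curl term: `curlL1 ≤ 2·#Plane·dirL1`
  have hcurl : ∑ π : T4AveragingDeficitWall.Plane d, ∑ x ∈ periodBox (d := d) P, ‖curl U ψ (x, π)‖
      ≤ 2 * Fintype.card (T4AveragingDeficitWall.Plane d) * dirL1 ψ (periodBox (d := d) P) := by
    have h := curlL1_le_periodic hU hP hψP
    unfold T4AveragingDeficitWall.curlL1 at h
    rw [Finset.sum_comm] at h
    exact h
  -- the bond term: `Σ_π (S_{π₁} + S_{π₂}) ≤ #Plane·dirL1`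
  have hshift : ∀ (μ ν : Fin d), ∑ x ∈ periodBox (d := d) P, ‖ψ (x + e ν) μ‖ = ∑ x ∈ periodBox (d := d) P, ‖ψ x μ‖ := fun μ ν =>
    sum_periodBox_shift P hP (g := fun x => ‖ψ x μ‖) (fun x κ => by rw [hψP x κ μ]) (e ν)
  have hS0 : ∀ κ : Fin d, 0 ≤ ∑ x ∈ periodBox (d := d) P, ‖ψ x κ‖ := fun κ => Finset.sum_nonneg fun _ _ => norm_nonneg _
  have hdir : dirL1 ψ (periodBox (d := d) P) = ∑ κ : Fin d, ∑ x ∈ periodBox (d := d) P, ‖ψ x κ‖ := by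
    unfold T4AveragingDeficitWall.dirL1; rw [Finset.sum_comm]
  have hbond : (∑ π : T4AveragingDeficitWall.Plane d, ∑ x ∈ periodBox (d := d) P, ‖ψ (x + e π.1.2) π.1.1‖)
        + ∑ π : T4AveragingDeficitWall.Plane d, ∑ x ∈ periodBox (d := d) P, ‖ψ x π.1.2‖
      ≤ Fintype.card (T4AveragingDeficitWall.Plane d) * dirL1 ψ (periodBox (d := d) P) := by
    rw [← Finset.sum_add_distrib]
    calc ∑ π : T4AveragingDeficitWall.Plane d,
          (∑ x ∈ periodBox (d := d) P, ‖ψ (x + e π.1.2) π.1.1‖ + ∑ x ∈ periodBox (d := d) P, ‖ψ x π.1.2‖)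
        = ∑ π : T4AveragingDeficitWall.Plane d,
            (∑ x ∈ periodBox (d := d) P, ‖ψ x π.1.1‖ + ∑ x ∈ periodBox (d := d) P, ‖ψ x π.1.2‖) :=
          Finset.sum_congr rfl fun π _ => by rw [hshift]
      _ ≤ ∑ _π : T4AveragingDeficitWall.Plane d, dirL1 ψ (periodBox (d := d) P) :=
          Finset.sum_le_sum fun π _ => by rw [hdir]; exact pair_le_sum hS0 π
      _ = Fintype.card (T4AveragingDeficitWall.Plane d) * dirL1 ψ (periodBox (d := d) P) := by
          rw [Finset.sum_const, Finset.card_univ, nsmul_eq_mul]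
  have ha4 : 0 ≤ 4 * a ^ 2 := by positivity
  nlinarith [mul_le_mul_of_nonneg_left hcurl ha4, mul_le_mul_of_nonneg_left hbond ha4]

/-- **CRITICALITY ⇒ THE TENSION IS `a²`-ORTHOGONAL TO THE DIRECTION**: if in addition `U` is critical along `ψ` for the periodic Wilson action
(`HasDerivAt … 0 0` — the shape `NE3FineCriticalGeneral.hasDerivAt_fineAction_vary_of_isMinOn` produces for constraint-tangent `ψ`), then
`|Σ_x Σ_ν hsR (frame U ψ x ν) (Σ_μ ∇_μ^† B_{μν}(x))| ≤ 12·#Plane(d)·a²·dirL1 ψ (periodBox P)`. [folklore] -/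
theorem tension_pairing_le_of_critical [Nonempty n] {P : ℕ} (hP : 1 ≤ P) (hU : IsUnitaryCfg U) (hUP : IsPeriodicCfg U (P : ℤ))
    {a : ℝ} (ha0 : 0 ≤ a) (ha : a ≤ 1 / 4) (hUa : SmallField U a) (hψs : IsSkewDir ψ) (hψP : IsPeriodicDir ψ (P : ℤ))
    (hBF : ∀ (x : Site d) (μ ν : Fin d) (h : μ < ν), B x μ ν = flux U (x, ⟨(μ, ν), h⟩))
    (hanti : ∀ (x : Site d) (μ ν : Fin d), B x ν μ = -B x μ ν)
    (hcrit : HasDerivAt (fun s : ℝ => fineAction (vary U ψ s) (plaqsOf (periodBox (d := d) P))) 0 0) :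
    |∑ x ∈ periodBox (d := d) P, ∑ ν : Fin d, hsR (frame U ψ x ν) (∑ μ : Fin d, cDstar U μ (fun y => B y μ ν) x)|
      ≤ 12 * (Fintype.card (T4AveragingDeficitWall.Plane d) : ℝ) * a ^ 2 * dirL1 ψ (periodBox (d := d) P) := by
  have h := firstVariation_sub_tension_pairing_le hP hU hUP ha0 ha hUa hψs hψP hBF hanti hcrit
  rwa [zero_sub, abs_neg] at h

end FluxForm

end

end Summit.QuantumFields.BalabanUV.T4Continuum.NE7TensionPairing
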